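import Summits.BirchSwinnertonDyer.BirchSwinnertonDyer.Theorems.ShaPrimaryTransferFiniteShaComponentTransferOddDoor
import Literature.NumberTheory.EllipticCurves.SelmerCorankIsogenyProofs
import HarnessLib

/-!
# BirchSwinnertonDyer / ShaPrimaryTransfer — crux `FiniteShaComponentTransfer` (stmt-BirchSwinnertonDyer-22356):
# THE ODD DOOR, part 2 — a descent defect of dimension ≤ 1 COMPUTES `t_p`; the unconditional rank dichotomy
# of a first descent; T from `p`-parity plus «corank ≤ 1 everywhere»

Second helper file of prover seat `bsd-line-spt-p1` g13 (`--supports stmt-22356 --as helper`), continuing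
`…FiniteShaComponentTransferOddDoor` (p680317; same namespace; split only for the 400-line rule). THEOREMS ONLY
(no definition, no `sorry`); the only named-fact hypotheses are the explicit `p_parity` ones in §6.

For an elliptic curve `E` over a number field `K : Type`, a prime `p`, `t_p(E) = W.shaCorank p = corank Ш(E/K)[p^∞]`:

* §5 `shaCorank_eq_of_natCard_eq_pow_of_le_one`: **`#Ш(E/K)[p] = p^d` with `d ≤ 1` ⟹ `t_p(E) = d`** (a descent
  defect of at most one dimension computes the corank exactly: `t_p ≤ d`, `t_p ≡ d (mod 2)`); in particular
  `#Ш[p] = p ⟹ t_p = 1`, `Ш[p^∞]` infinite (`shaCorank_eq_one_of_natCard_eq`, `infinite_shaPrimary_of_natCard_eq`).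
  Exact descent bookkeeping `rank + t_p ≤ s - t`, `rank + t_p ≡ s - t (mod 2)` for `#Sel^(p) = p^s`, `#E(K)[p] = p^t`
  (`rank_add_shaCorank_le_and_mod_two_eq`), and **THE RANK DICHOTOMY** of a first descent, unconditional: if
  `s = t + r₀ + 1` with `r₀ ≤ rank E(K)` known points, then `rank = r₀ + 1 ∧ t_p = 0` or `rank = r₀ ∧ t_p = 1`
  (`rank_eq_succ_or_rank_eq_and_shaCorank_eq_one`; `rank = r₀ + 1` once `Ш[p^∞]` is finite,
  `rank_eq_succ_of_finite_shaPrimary`) — "parity tells you to keep searching", with the alternative made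
  explicit as an infinite `Ш[p^∞]`.
* §6 THE ROUTE (`K = ℚ`): granting `p`-parity at `p` and `q` (named fact `p_parity`, CONDITIONAL): `t_p(E) = 0 ⟹
  t_q(E)` even (`even_shaCorank_of_p_parity`), so T holds at `(E, p, q)` whenever `t_q(E) ≤ 1`
  (`transferAt_of_p_parity_of_shaCorank_le_one`; descent form `defect_eq_zero_of_p_parity_of_le_one`), and the
  RESHAPING REMARK `finiteShaComponentTransfer_of_p_parity_of_shaCorank_le_one`: **T ⟸ (DD `p`-parity, PRINT) ∧
  («`corank Ш(E)[q^∞] ≤ 1` for all `E/ℚ`, `q`»)** — the second conjunct is strictly weaker than finiteness of `Ш`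
  (it allows `Ш_div ≅ ℚ/ℤ`); T can only fail at a prime `q` with `(ℚ_q/ℤ_q)² ⊆ Ш(E)`. Also: granting `p`-parity at ONE
  prime `q` in analytic form (`selmerCorank_mod_two_eq E q`), the rank-parity conjecture for `E` holds iff `#Ш(E)[q]` is
  a square (`rank_mod_two_eq_analyticRank_iff_isSquare`) and every `q`-descent reports `s ≡ t + ord L (mod 2)`
  (`selmerRank_mod_two_eq_analyticRank_of_p_parity`).

* §7 ACROSS AN ISOGENY CLASS (any `K`): `p`-descent defects of `K`-isogenous curves have the same parity
  (`defect_mod_two_eq_of_isIsogenous`, from `IsIsogenous.shaCorank_eq`); ONE closed `p`-descent in the class makes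
  every other `#Ш(E)[p]` a square and every other `p`-Selmer rank `≡ t + rank (mod 2)`
  (`isSquare_natCard_sha_torsionBy_of_isIsogenous_of_natCard_eq_one`,
  `selmerRank_mod_two_eq_of_isIsogenous_of_natCard_eq_one`) — the unconditional content behind the route's
  ISOGENY DOOR (g11) — and a non-square defect anywhere opens the door for the whole class
  (`one_le_shaCorank_of_isIsogenous_of_not_isSquare`).

Nothing here proves T, O or BSD; T stays conjecture-grade at analytic rank ≥ 2.

References: [Dokchitser2013ParityNotes] T. Dokchitser, Notes on the parity conjecture (2013), §2;
[DokchitserDokchitserAnnals2010] T. and V. Dokchitser, Ann. of Math. 172 (2010), Thm. 1.4; [SilvermanAEC2009]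
Thm. X.4.2, X.4.14; [Cassels1962ArithmeticIV] Thm. 1.1; [MilneADT2006] Ch. I Lemma 7.1(b).
-/

-- D-0017: single-problem summit, so `Summit.BirchSwinnertonDyer.BirchSwinnertonDyer.…` repeats a namespace BY DESIGN.
set_option linter.dupNamespace false
set_option autoImplicit false

noncomputable section

open scoped Classical
open scoped AddSubgroup
open Literature.NumberTheory.EllipticCurves WeierstrassCurve

namespace Summit.BirchSwinnertonDyer.BirchSwinnertonDyer.Theorems.ShaPrimaryTransferOddDoor

/-! ## §5 A descent defect of at most one dimension COMPUTES `t_p`; the rank dichotomy -/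

section DefectLeOne

variable {K : Type} [Field K] [NumberField K] (W : WeierstrassCurve K) [W.IsElliptic]
  (p : ℕ) [hp : Fact p.Prime]

/-- **A `p`-descent defect of at most one dimension computes `t_p(E)` EXACTLY**: if `#Ш(E/K)[p] = p^d` with
`d ≤ 1` then `t_p(E) = d` (`t_p ≤ d` and `t_p ≡ d (mod 2)`). So `Ш[p] = 0` gives `t_p = 0` (the door) and
`#Ш[p] = p` gives `t_p = 1`. [cite: Dokchitser2013ParityNotes, §2] -/
theorem shaCorank_eq_of_natCard_eq_pow_of_le_one {d : ℕ} (hd : Nat.card (W.sha[(p : ℤ)]) = p ^ d)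
    (hd1 : d ≤ 1) : W.shaCorank p = d := by
  obtain ⟨m, hm⟩ := exists_eq_shaCorank_add_two_mul W p hd
  omega

/-- **One undecided dimension certifies infinite `Ш`**: `#Ш(E/K)[p] = p` ⟹ `t_p(E) = 1`.
[cite: Dokchitser2013ParityNotes, §2] -/
theorem shaCorank_eq_one_of_natCard_eq (hd : Nat.card (W.sha[(p : ℤ)]) = p) : W.shaCorank p = 1 :=
  shaCorank_eq_of_natCard_eq_pow_of_le_one W p (d := 1) (by rw [hd, pow_one]) le_rfl

/-- … and hence `Ш(E/K)[p^∞]` is infinite. [cite: Dokchitser2013ParityNotes, §2] -/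
theorem infinite_shaPrimary_of_natCard_eq (hd : Nat.card (W.sha[(p : ℤ)]) = p) :
    Infinite ↥(AddCommGroup.primaryComponent W.sha p) :=
  infinite_shaPrimary_of_natCard_eq_pow_odd W p (d := 1) (by rw [hd, pow_one]) odd_one

/-- **Descent bookkeeping, exact**: with `#Sel^(p)(E/K) = p^s`, `#E(K)[p] = p^t`:
`rank E(K) + t_p(E) ≤ s - t` and `rank E(K) + t_p(E) ≡ s - t (mod 2)`.
[cite: Dokchitser2013ParityNotes, §2 (first display and Definition)] -/
theorem rank_add_shaCorank_le_and_mod_two_eq (s t : ℕ) (hs : Nat.card (W.selmerGroup p) = p ^ s)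
    (ht : Nat.card (W.toAffine.Point[(p : ℤ)]) = p ^ t) :
    W.mordellWeilRank + W.shaCorank p ≤ s - t ∧ (W.mordellWeilRank + W.shaCorank p) % 2 = (s - t) % 2 := by
  obtain ⟨m, hm⟩ := exists_selmerRank_eq_rank_add_shaCorank_add W p s t hs ht
  omega

/-- **THE RANK DICHOTOMY of a first descent, unconditional** (the classical "parity tells you to keep
searching"): if a complete `p`-descent gives `#Sel^(p)(E/K) = p^s`, `#E(K)[p] = p^t` with `s = t + r₀ + 1`, and
`r₀` independent points are known (`r₀ ≤ rank E(K)`), then EITHER `rank E(K) = r₀ + 1` (and `t_p(E) = 0`) OR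
`rank E(K) = r₀` and `t_p(E) = 1` — in the second case `Ш(E/K)[p^∞]` is infinite
(`finite_primaryComponent_sha_iff_shaCorank_eq_zero`). [cite: Dokchitser2013ParityNotes, §2] -/
theorem rank_eq_succ_or_rank_eq_and_shaCorank_eq_one (s t r₀ : ℕ) (hs : Nat.card (W.selmerGroup p) = p ^ s)
    (ht : Nat.card (W.toAffine.Point[(p : ℤ)]) = p ^ t) (hst : s = t + r₀ + 1) (hr : r₀ ≤ W.mordellWeilRank) :
    (W.mordellWeilRank = r₀ + 1 ∧ W.shaCorank p = 0) ∨ (W.mordellWeilRank = r₀ ∧ W.shaCorank p = 1) := by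
  obtain ⟨m, hm⟩ := exists_selmerRank_eq_rank_add_shaCorank_add W p s t hs ht
  omega

/-- Corollary: in the situation of the dichotomy, `rank E(K) = r₀ + 1` as soon as `Ш(E/K)[p^∞]` is finite
(e.g. granting finiteness of `Ш`, or over `ℚ` in analytic rank `≤ 1` by Gross–Zagier–Kolyvagin).
[cite: Dokchitser2013ParityNotes, §2] -/
theorem rank_eq_succ_of_finite_shaPrimary (s t r₀ : ℕ) (hs : Nat.card (W.selmerGroup p) = p ^ s)
    (ht : Nat.card (W.toAffine.Point[(p : ℤ)]) = p ^ t) (hst : s = t + r₀ + 1) (hr : r₀ ≤ W.mordellWeilRank)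
    [hfin : Finite ↥(AddCommGroup.primaryComponent W.sha p)] : W.mordellWeilRank = r₀ + 1 := by
  have h0 : W.shaCorank p = 0 := (finite_primaryComponent_sha_iff_shaCorank_eq_zero W p).mp hfin
  rcases rank_eq_succ_or_rank_eq_and_shaCorank_eq_one W p s t r₀ hs ht hst hr with h | h <;> omega

end DefectLeOne

/-! ## §6 The route: T at `(E, p, q)` from `p`-parity and `t_q ≤ 1` -/

section RouteLeOne

open Summit.BirchSwinnertonDyer.BirchSwinnertonDyer.Theses.ShaPrimaryTransfer (FiniteShaComponentTransfer)

variable (p : ℕ) [hp : Fact p.Prime] (E : WeierstrassCurve ℚ) [E.IsElliptic] (q : ℕ) [hq : Fact q.Prime]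

/-- `p`-parity at `p` and at `q` (named fact `p_parity`, CONDITIONAL) transfers the PARITY of the corank:
`t_p(E) = 0 ⟹ t_q(E)` even (cf. `ShaPrimaryTransferSlices.even_shaCorank_of_shaCorank_eq_zero_of_p_parity`;
re-proved here to keep this file out of the cone of the `Slices` module). [cite: DokchitserDokchitserAnnals2010, Thm. 1.4] -/
theorem even_shaCorank_of_p_parity (hpp : p_parity E p) (hpq : p_parity E q) (h0 : E.shaCorank p = 0) :
    Even (E.shaCorank q) :=
  (isSquare_natCard_sha_torsionBy_iff_even_shaCorank E q).mp
    (isSquare_natCard_sha_torsionBy_of_p_parity p E q hpp hpq h0)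

/-- **T at `(E, p, q)` from `p`-parity and `t_q(E) ≤ 1`**: granting `p`-parity at `p` and `q` (CONDITIONAL named
fact), a closed door `t_p(E) = 0` and `corank Ш(E)[q^∞] ≤ 1` give `t_q(E) = 0`. So T can only fail at a prime
`q` where `Ш(E)` contains `(ℚ_q/ℤ_q)²`. [cite: DokchitserDokchitserAnnals2010, Thm. 1.4] -/
theorem transferAt_of_p_parity_of_shaCorank_le_one (hpp : p_parity E p) (hpq : p_parity E q)
    (h1 : E.shaCorank q ≤ 1) (h0 : E.shaCorank p = 0) : E.shaCorank q = 0 := by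
  obtain ⟨k, hk⟩ := even_shaCorank_of_p_parity p E q hpp hpq h0
  omega

/-- Descent form: granting `p`-parity at `p` and `q`, behind a closed door NO `q`-descent leaves a defect of at
most one dimension unless it closes — `t_p(E) = 0`, `#Ш(E)[q] = q^d`, `d ≤ 1 ⟹ d = 0`.
[cite: DokchitserDokchitserAnnals2010, Thm. 1.4] -/
theorem defect_eq_zero_of_p_parity_of_le_one (hpp : p_parity E p) (hpq : p_parity E q) (h0 : E.shaCorank p = 0)
    {d : ℕ} (hd : Nat.card (E.sha[(q : ℤ)]) = q ^ d) (hd1 : d ≤ 1) : d = 0 := by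
  have h := shaCorank_eq_of_natCard_eq_pow_of_le_one E q hd hd1
  have h' := transferAt_of_p_parity_of_shaCorank_le_one p E q hpp hpq (by omega) h0
  omega

omit hp E hq in
/-- **RESHAPING REMARK — T ⟸ PRINT ∧ «corank ≤ 1 everywhere»**: granting the `p`-parity theorem for every curve
and prime (named fact `p_parity`, Dokchitser–Dokchitser 2010 Thm. 1.4 — PRINT, not discharged in the tree), the
crux T = `FiniteShaComponentTransfer` follows from «`corank_{ℤ_q} Ш(E)[q^∞] ≤ 1` for every elliptic `E/ℚ` and
every prime `q`» — a statement strictly weaker than the finiteness of `Ш` (it allows `Ш_div ≅ ℚ/ℤ`). Not filed as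
an item (planner's call); recorded so the census can name it. [cite: DokchitserDokchitserAnnals2010, Thm. 1.4] -/
theorem finiteShaComponentTransfer_of_p_parity_of_shaCorank_le_one
    (hpar : ∀ (V : WeierstrassCurve ℚ) [V.IsElliptic] (ℓ : ℕ) [Fact ℓ.Prime], p_parity V ℓ)
    (hle : ∀ (V : WeierstrassCurve ℚ) [V.IsElliptic] (ℓ : ℕ) [Fact ℓ.Prime], V.shaCorank ℓ ≤ 1) :
    FiniteShaComponentTransfer := by
  intro V _ p' q' _ _ h0
  exact transferAt_of_p_parity_of_shaCorank_le_one p' V q' (hpar V p') (hpar V q') (hle V q') h0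

/-- **The rank-parity conjecture for `E`, read on ONE descent defect** (no door needed): granting the `p`-parity
theorem at `p` in analytic form (named fact `selmerCorank_mod_two_eq E p`: `corank Sel_{p^∞} ≡ ord_{s=1} L (mod 2)`,
CONDITIONAL), `rank E(ℚ) ≡ ord_{s=1} L(E,s) (mod 2)` holds iff `#Ш(E)[p]` is a perfect square (iff `t_p(E)` is
even — the tree's `mordellWeilRank_mod_two_eq_iff_even_shaCorank` — iff, by §1, the `p`-descent defect is a
square). So a closed door is more than parity needs: a SQUARE defect at one prime already gives the parity
conjecture for `E`, and an odd door at one prime refutes it for `E`.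
[cite: DokchitserDokchitserAnnals2010, §1 (Conj. 1.1, 1.2) and Thm. 1.4] [cite: SilvermanAEC2009, Thm. X.4.14] -/
theorem rank_mod_two_eq_analyticRank_iff_isSquare (hpar : selmerCorank_mod_two_eq E q) :
    E.mordellWeilRank % 2 = E.analyticRank % 2 ↔ IsSquare (Nat.card (E.sha[(q : ℤ)])) := by
  rw [isSquare_natCard_sha_torsionBy_iff_even_shaCorank E q, Nat.even_iff]
  have e1 : E.selmerCorank q % 2 = E.analyticRank % 2 := hpar
  have e2 : E.selmerCorank q = E.mordellWeilRank + E.shaCorank q := E.selmerCorank_eq_mordellWeilRank_add_holds q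
  omega

/-- Selmer form of the same: granting `selmerCorank_mod_two_eq E q`, with `#Sel^(q)(E/ℚ) = q^s`, `#E(ℚ)[q] = q^t`:
`s ≡ t + ord_{s=1} L(E,s) (mod 2)` — the `q`-Selmer rank has the parity of the ANALYTIC rank, unconditionally in
`rank E(ℚ)` (which cancels). This is the form in which descent tables are checked against root numbers.
[cite: DokchitserDokchitserAnnals2010, Thm. 1.4] -/
theorem selmerRank_mod_two_eq_analyticRank_of_p_parity (hpar : selmerCorank_mod_two_eq E q) (s t : ℕ)
    (hs : Nat.card (E.selmerGroup q) = q ^ s) (ht : Nat.card (E.toAffine.Point[(q : ℤ)]) = q ^ t) :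
    s % 2 = (t + E.analyticRank) % 2 := by
  obtain ⟨m, hm⟩ := exists_selmerRank_eq_selmerCorank_add E q s t hs (by convert ht)
  have e1 : E.selmerCorank q % 2 = E.analyticRank % 2 := hpar
  omega

end RouteLeOne

/-! ## §7 The odd door across an isogeny class: one closed `p`-descent makes every isogenous
`p`-descent defect a square -/

section IsogenyClass

variable {K : Type} [Field K] [NumberField K] {W W' : WeierstrassCurve K} [W.IsElliptic] [W'.IsElliptic]
  (p : ℕ) [hp : Fact p.Prime]

/-- **Across a `K`-isogeny class the `p`-descent defects all have the parity of the common corank**: for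
`K`-isogenous elliptic `E ~ E'` and `#Ш(E/K)[p] = p^d`, `#Ш(E'/K)[p] = p^{d'}`: `d ≡ d' (mod 2)` (both
`≡ t_p(E) = t_p(E')`, `IsIsogenous.shaCorank_eq`). `Ш[p]` itself is NOT an isogeny invariant (Cassels'
isogeny formula moves `p`-torsion of `Ш` across a `p`-isogeny); its parity is.
[cite: MilneADT2006, Ch. I Lemma 7.1(b) (proof), p. 96] [cite: Dokchitser2013ParityNotes, §2] -/
theorem defect_mod_two_eq_of_isIsogenous (h : IsIsogenous W W') {d d' : ℕ}
    (hd : Nat.card (W.sha[(p : ℤ)]) = p ^ d) (hd' : Nat.card (W'.sha[(p : ℤ)]) = p ^ d') :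
    d % 2 = d' % 2 := by
  have h1 := shaCorank_mod_two_eq W p hd
  have h2 := shaCorank_mod_two_eq W' p hd'
  have h3 := h.shaCorank_eq p
  omega

/-- **One closed `p`-descent in the class squares every other defect**: if `E ~ E'` over `K` and
`Ш(E'/K)[p] = 0` (`#Ш(E')[p] = 1`), then `#Ш(E/K)[p]` is a perfect square (`t_p(E) = t_p(E') = 0` and §1).
This is the unconditional content behind the route's ISOGENY DOOR (seat g11: `t_2(X) = 0` with
`Ш(X)[2] ≅ (ℤ/2)²` certified through an isogenous curve whose `2`-descent closes): such an `X` can never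
show a non-square defect. [cite: SilvermanAEC2009, Thm. X.4.14] [cite: MilneADT2006, Ch. I Lemma 7.1(b) (proof), p. 96] -/
theorem isSquare_natCard_sha_torsionBy_of_isIsogenous_of_natCard_eq_one (h : IsIsogenous W W')
    (h1 : Nat.card (W'.sha[(p : ℤ)]) = 1) : IsSquare (Nat.card (W.sha[(p : ℤ)])) :=
  isSquare_natCard_sha_torsionBy_of_shaCorank_eq_zero W p
    ((h.shaCorank_eq p).trans (shaCorank_eq_zero_of_natCard_sha_torsionBy_eq_one W' p h1))

/-- Selmer form: if `E ~ E'` over `K` and `Ш(E'/K)[p] = 0`, then every `p`-descent of `E` reports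
`s ≡ t + rank E(K) (mod 2)` (`#Sel^(p)(E/K) = p^s`, `#E(K)[p] = p^t`). [cite: Dokchitser2013ParityNotes, §2] -/
theorem selmerRank_mod_two_eq_of_isIsogenous_of_natCard_eq_one (h : IsIsogenous W W')
    (h1 : Nat.card (W'.sha[(p : ℤ)]) = 1) (s t : ℕ) (hs : Nat.card (W.selmerGroup p) = p ^ s)
    (ht : Nat.card (W.toAffine.Point[(p : ℤ)]) = p ^ t) : s % 2 = (t + W.mordellWeilRank) % 2 := by
  obtain ⟨m, hm⟩ := exists_selmerRank_eq_rank_add_shaCorank_add W p s t hs ht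
  have h0 : W.shaCorank p = 0 :=
    (h.shaCorank_eq p).trans (shaCorank_eq_zero_of_natCard_sha_torsionBy_eq_one W' p h1)
  omega

/-- **A non-square defect anywhere in the class opens the door for the whole class**: if `E ~ E'` and
`#Ш(E/K)[p]` is not a square then `t_p(E') ≥ 1`, so NO curve of the class has `Ш[p] = 0`.
[cite: MilneADT2006, Ch. I Lemma 7.1(b) (proof), p. 96] [cite: Dokchitser2013ParityNotes, §2] -/
theorem one_le_shaCorank_of_isIsogenous_of_not_isSquare (h : IsIsogenous W W')
    (hodd : ¬ IsSquare (Nat.card (W.sha[(p : ℤ)]))) : 1 ≤ W'.shaCorank p := by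
  rw [← h.shaCorank_eq p]
  exact one_le_shaCorank_of_not_isSquare W p hodd

/-- … in `Nat.card` form: then `#Ш(E'/K)[p] ≠ 1` for every `E' ~ E`. [cite: Dokchitser2013ParityNotes, §2] -/
theorem natCard_sha_torsionBy_ne_one_of_isIsogenous_of_not_isSquare (h : IsIsogenous W W')
    (hodd : ¬ IsSquare (Nat.card (W.sha[(p : ℤ)]))) : Nat.card (W'.sha[(p : ℤ)]) ≠ 1 :=
  natCard_sha_torsionBy_ne_one_of_shaCorank_ne_zero W' p
    (by have := one_le_shaCorank_of_isIsogenous_of_not_isSquare p h hodd; omega)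

end IsogenyClass

end Summit.BirchSwinnertonDyer.BirchSwinnertonDyer.Theorems.ShaPrimaryTransferOddDoor

end
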